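import Summits.Langlands.Langlands.Statement
import Literature.NumberTheory.Automorphic.BaseChangeInductionAlong
import Literature.NumberTheory.Automorphic.IsAutomorphicAE
import Literature.NumberTheory.GaloisRepresentations.HeckeCharacter
import HarnessLib

/-!
# F4 `_onpath` — the rung is a consequence of the summit (line `CubicInductionGL2`, crux `ReciprocityUpToIrreducibility`,
item stmt-Langlands-14328; G4 ladder-down generation 23)

`CubicInductionGL2_of_Langlands : Langlands → CubicInductionGL2` (tagged `@[aesop safe apply]`): clause (B) of `Langlands` over
the base field `F` (for the reciprocity datum the summit's non-vacuity conjunct provides) applied to the irreducible geometric `ρ` of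
rank `3m` of the family; `Corresponds` restricted to its a.e. Satake clause.  Proved for every rank `m` (`cubicInducedReciprocity_of_langlands`;
the hypotheses on `π_E` are not used — the family is typed inside clause (B)).  No `sorry`.
-/

noncomputable section

set_option linter.dupNamespace false

open scoped MatrixGroups Matrix NumberField Classical Polynomial
open Filter IsDedekindDomain Field Polynomial NumberField
open Literature.NumberTheory.Automorphic Literature.NumberTheory.GaloisRepresentations
open Literature.NumberTheory.PAdicHodge
open Summit.Langlands

namespace Summit.Langlands.Langlands.Cruxes.ReciprocityUpToIrreducibility.CubicInductionGL2

/-- **The RUNG FAMILY, dial = the rank `m` of the induced representation** (verbatim as in `_onpath` / `_special`):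
for all number fields `F`, all CUBIC extensions `E/F` (ANY Galois closure: `C₃` or `S₃`), all cuspidal automorphic
`π_E` of `GL_m(𝔸_E)` (`0 < m`) with UNITARY central character (the Hecke character `ω` with `ω(ϖ_w) = det t_{π_E,w}`,
Borel–Jacquet 5.7; at `m = 1` this is the floor's `θ.IsUnitary`), all `ℓ, ι` and all framed
`ρ : Γ_F → GL_{3m}(ℚ̄_ℓ)` which are irreducible, de Rham above `ℓ` (Fontaine's pinned datum) and, at almost every place
`v`, unramified with Frobenius characteristic polynomial the `ι`-transport of the Arthur–Clozel induced polynomial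
`∏_{w ∣ v} P_{π_E,w}(X^{f(w|v)})` of the Satake data of `π_E` above `v` (through any multiset `α` of its roots, in the
dictionary `arithFrobPolyOfSatake`): `ρ` is attached at almost all places to an automorphic representation of
`GL_{3m}(𝔸_F)`. -/
def CubicInducedReciprocity (m : ℕ) : Prop :=
  ∀ (F E : Type) [Field F] [NumberField F] [Field E] [NumberField E] [Algebra F E],
    Module.finrank F E = 3 → 0 < m →
    ∀ (hE : isCompact_glFiniteIntegralLevel m E) (πE : CuspidalAutomorphicRepData m E hE),
      (∃ ω : HeckeCharacter E, ω.IsUnitary ∧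
          ∀ (w : HeightOneSpectrum (𝓞 E)) (α : Multiset ℂ), πE.1.HasSatakeParamAt w α →
            ω.valueAtUniformizer w = α.prod) →
      ∀ (hF : isCompact_glFiniteIntegralLevel (3 * m) F) (ℓ : ℕ) [Fact ℓ.Prime] (ι : PadicAlgCl ℓ ≃+* ℂ)
        (ρ : FramedGaloisRep F (PadicAlgCl ℓ) (3 * m)),
        ρ.toGaloisRep.IsIrreducible →
        (∀ (w : HeightOneSpectrum (𝓞 F)) (hw : ((ℓ : ℕ) : 𝓞 F) ∈ w.asIdeal),
            (fontainePstAdicCompletion w ℓ hw).IsDeRhamFramed (ρ.toLocal w)) →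
        (∀ᶠ v : HeightOneSpectrum (𝓞 F) in cofinite, ρ.IsUnramifiedAt v ∧
            ∀ β : HeightOneSpectrum (𝓞 E) → Multiset ℂ,
              (∀ w : HeightOneSpectrum (𝓞 E), w.asIdeal.under (𝓞 F) = v.asIdeal →
                  πE.1.HasSatakeParamAt w (β w)) →
              ∀ α : Multiset ℂ, satakePolynomial α = inducedSatakePolynomial v β →
                ρ.HasFrobCharpolyAt v (arithFrobPolyOfSatake ι v.residueCard 1 α)) →
        ∃ π : AutomorphicRepData (AutomorphyDatum.gl (3 * m) F hF), SatakeFrobCompatibleAE ι π ρ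

/-- **THE RUNG (θ25 = 2)**: automorphic induction of cuspidal representations of `GL₂(𝔸_E)` through ARBITRARY cubic
extensions `E/F` to `GL₆(𝔸_F)`, in clause-(B) form. -/
def CubicInductionGL2 : Prop := CubicInducedReciprocity 2

/-- `Langlands → CubicInducedReciprocity m` for every `m` (the F4 on-path lemma, also in `_onpath`). -/
theorem cubicInducedReciprocity_of_langlands (m : ℕ) (hL : _root_.Langlands) : CubicInducedReciprocity m := by
  intro F E _ _ _ _ _ _h3 hm hE' πE _hω hF ℓ _ ι ρ hirr hdR hfrob
  obtain ⟨⟨Rec⟩, hall⟩ := hL F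
  have hn : 0 < 3 * m := by omega
  have hB : GaloisToAutomorphic (3 * m) Rec hF := (hall Rec (3 * m) hn hF).2
  have hgeo : IsGeometricFramed Rec ρ := ⟨hfrob.mono fun v hv => hv.1, fun w hw => hdR w hw⟩
  obtain ⟨π, _hLalg, hcorr⟩ := hB ℓ ι ρ hirr hgeo
  exact ⟨π.1, hcorr.1⟩

/-- **F4 on-path lemma**: `S → Rung`. -/
@[aesop safe apply]
theorem CubicInductionGL2_of_Langlands (hL : _root_.Langlands) : CubicInductionGL2 :=
  cubicInducedReciprocity_of_langlands 2 hL


end Summit.Langlands.Langlands.Cruxes.ReciprocityUpToIrreducibility.CubicInductionGL2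

end
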